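import Literature.Analysis.Fourier.ContinuousAddCharReal
import Literature.NumberTheory.Automorphic.AdelicGLnGlue
import Literature.NumberTheory.Automorphic.AdeleAddCharLocalComponentsNontrivial
import HarnessLib

/-!
# The archimedean part of a character of `𝔸_K/K` is `x ↦ e(ℓ x)` with `ℓ` non-degenerate

Topic `NumberTheory/Automorphic`; theorems only (no definition, no named fact).

For a number field `K` and a global additive character `ψ` (`IsGlobalAddChar K ψ` of
`GlobalAdditiveCharacter`: a continuous character `𝔸_K → 𝕊`, trivial on `K`, `ψ ≠ 1`), the restriction
of `ψ` to the archimedean quasifactor `K_∞ = ∏_{σ∣∞} K_σ ≅ ℝ^{r₁} × ℂ^{r₂}` (Mathlib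
`InfiniteAdeleRing.ringEquiv_mixedSpace`) is `x ↦ e(ℓ(x))` for a real linear form `ℓ` on
`ℝ^{r₁} × ℂ^{r₂}` (`IsGlobalAddChar.exists_linearMap_fourierChar_eq`; Bump, *Automorphic Forms and
Representations*, §3.1: *"Every character of `ℝ` has the form `χ_a(t) = e^{2πiat}`"*, through the tree's
`Analysis.Fourier.exists_linearMap_fourierChar_eq_of_continuous`), and — because EVERY archimedean
component `ψ_σ` is non-trivial (Weil, *Basic Number Theory*, Chap. IV §2, Cor. 1 of Th. 3;
`IsGlobalAddChar.archComponent_ne_one` of `AdeleAddCharLocalComponentsNontrivial`) — the form `ℓ` is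
NON-DEGENERATE for the ring structure: for every `r ≠ 0` there is `c` with `ℓ(c r) ≠ 0`, and `ℓ` is onto.

These are, verbatim, the hypotheses `hℓ` of
`RepresentationTheory.HeisenbergGroup.nondegenerate_realForm_sub_flip` (non-degeneracy of the real
commutator form `ℓ(B − Bᵀ)` of an archimedean Heisenberg group with central character `e ∘ ℓ`) and
`Function.Surjective ℓ` of `exists_linearIsometryEquiv_of_irreducible_of_centralChar` (archimedean
Stone–von Neumann uniqueness), for the character `ψ` as quantified in
`GelbartRogawski1991.Prop311AsPrinted` ("`ψ` a non-trivial additive character of `F\\𝐀`", p. 449 L32).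

## References

* D. Bump, *Automorphic Forms and Representations* (1997), §3.1, opening discussion and
  Exercise 3.1.1(f). [Bump1997]
* A. Weil, *Basic Number Theory* (1967), Chap. IV §2, Corollary 1 of Theorem 3. [WeilBNT1967]
-/

noncomputable section

open NumberField IsDedekindDomain NumberField.InfinitePlace NumberField.mixedEmbedding InfiniteAdeleRing
open scoped FourierTransform

namespace Literature.NumberTheory.Automorphic

variable (K : Type) [Field K] [NumberField K]

variable {K}

/-- **The archimedean part of a continuous character of `𝔸_K` is `x ↦ e(ℓ x)`**: for a continuous
`ψ : 𝔸_K → 𝕊` there is a real linear form `ℓ` on `ℝ^{r₁} × ℂ^{r₂}` with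
`ψ(x_∞, 0) = e(ℓ(ι x_∞))` for every `x_∞ ∈ K_∞` (`(x_∞, 0) = infiniteAdeleInl K x_∞`,
`ι = ringEquiv_mixedSpace`; the continuous characters of a finite-dimensional real vector space).
[cite: Bump1997, §3.1, opening discussion and Exercise 3.1.1(f)] -/
theorem exists_linearMap_fourierChar_eq_of_continuous_adeleRing
    {ψ : AddChar (AdeleRing (𝓞 K) K) Circle} (hψ : Continuous ψ) :
    ∃ ℓ : mixedSpace K →ₗ[ℝ] ℝ, ∀ x : InfiniteAdeleRing K,
      ψ (infiniteAdeleInl K x) = 𝐞 (ℓ (ringEquiv_mixedSpace K x)) := by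
  -- `χ = ψ ∘ (x ↦ (x, 0)) ∘ ι⁻¹`, a continuous character of the real vector space `ℝ^{r₁} × ℂ^{r₂}`
  set χ : AddChar (mixedSpace K) Circle :=
    ψ.compAddMonoidHom ((infiniteAdeleInl K : InfiniteAdeleRing K →+ AdeleRing (𝓞 K) K).comp
      (ringEquiv_mixedSpace K).symm.toAddMonoidHom) with hχ
  have hχc : Continuous χ :=
    hψ.comp ((continuous_infiniteAdeleInl K).comp (continuous_ringEquiv_mixedSpace_symm K))
  obtain ⟨ℓ, hℓ⟩ := Literature.Analysis.Fourier.exists_linearMap_fourierChar_eq_of_continuous χ hχc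
  refine ⟨ℓ, fun x => ?_⟩
  have h := hℓ (ringEquiv_mixedSpace K x)
  change ψ (infiniteAdeleInl K ((ringEquiv_mixedSpace K).symm (ringEquiv_mixedSpace K x))) = _ at h
  rw [RingEquiv.symm_apply_apply] at h
  exact h

/-- **The archimedean linear form of a global additive character is non-degenerate**: for `ψ` a
global additive character of `K` there is a real linear form `ℓ` on `ℝ^{r₁} × ℂ^{r₂} ≅ K_∞` with
(1) `ψ(x_∞, 0) = e(ℓ(ι x_∞))`; (2) for every `r ≠ 0` some `c` has `ℓ(c r) ≠ 0` (from the non-triviality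
of EVERY archimedean component `ψ_σ`: if `ℓ` killed the ideal generated by `r`, it would kill the
quasifactor `K_σ` at a place `σ` where `r_σ ≠ 0`); (3) `ℓ` is onto.  (1)–(3) are the hypotheses on
the central character `e ∘ ℓ` of the tree's archimedean Stone–von Neumann theorems
(`nondegenerate_realForm_sub_flip`, `exists_linearIsometryEquiv_of_irreducible_of_centralChar`).
[cite: WeilBNT1967, Chap. IV §2, Cor. 1 of Th. 3] -/
theorem IsGlobalAddChar.exists_linearMap_fourierChar_eq {ψ : AddChar (AdeleRing (𝓞 K) K) Circle}
    (hψ : IsGlobalAddChar K ψ) :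
    ∃ ℓ : mixedSpace K →ₗ[ℝ] ℝ,
      (∀ x : InfiniteAdeleRing K, ψ (infiniteAdeleInl K x) = 𝐞 (ℓ (ringEquiv_mixedSpace K x))) ∧
      (∀ r : mixedSpace K, r ≠ 0 → ∃ c : mixedSpace K, ℓ (c * r) ≠ 0) ∧
      Function.Surjective ℓ := by
  classical
  obtain ⟨ℓ, hℓ⟩ := exists_linearMap_fourierChar_eq_of_continuous_adeleRing hψ.continuous
  -- (2) non-degeneracy
  have hnd : ∀ r : mixedSpace K, r ≠ 0 → ∃ c : mixedSpace K, ℓ (c * r) ≠ 0 := by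
    intro r hr
    by_contra hcon
    push Not at hcon
    set x : InfiniteAdeleRing K := (ringEquiv_mixedSpace K).symm r with hx
    have hxr : ringEquiv_mixedSpace K x = r := by
      rw [hx]
      exact RingEquiv.apply_symm_apply _ _
    have hx0 : x ≠ 0 := by
      intro h
      apply hr
      rw [← hxr, h, map_zero]
    obtain ⟨w, hw⟩ : ∃ w : InfinitePlace K, x w ≠ 0 := by
      by_contra hall
      push Not at hall
      exact hx0 (funext hall)
    obtain ⟨y, hy⟩ :=
      exists_addChar_archSingle_ne_one hψ.continuous hψ.map_algebraMap hψ.ne_one w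
    apply hy
    -- `(0,…,y,…,0) = (0,…,y x_w⁻¹,…,0) · x`, so `ψ_w(y) = e(ℓ(c r)) = 1`
    have key : archSingle K w y =
        infiniteAdeleInl K ((archSingle K w (y * (x w)⁻¹)).1 * x) := by
      refine Prod.ext ?_ rfl
      funext w'
      change (Pi.single w y : ∀ v : InfinitePlace K, v.Completion) w' =
        (Pi.single w (y * (x w)⁻¹) : ∀ v : InfinitePlace K, v.Completion) w' * x w'
      by_cases h : w' = w
      · subst h
        rw [Pi.single_eq_same, Pi.single_eq_same, inv_mul_cancel_right₀ hw]
      · rw [Pi.single_eq_of_ne h, Pi.single_eq_of_ne h, zero_mul]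
    rw [key, hℓ, map_mul, hxr, hcon, AddChar.map_zero_eq_one]
  refine ⟨ℓ, hℓ, hnd, ?_⟩
  -- (3) `ℓ ≠ 0`, hence onto
  obtain ⟨c, hc⟩ := hnd 1 one_ne_zero
  rw [mul_one] at hc
  intro t
  refine ⟨(t / ℓ c) • c, ?_⟩
  rw [map_smul, smul_eq_mul, div_mul_cancel₀ t hc]

end Literature.NumberTheory.Automorphic

end
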